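import Mathlib.Probability.Moments.Covariance
import Mathlib.Analysis.CStarAlgebra.Matrix
import Literature.MathematicalPhysics.QuantumFieldTheory.THooftRegimeThresholds
import Literature.MathematicalPhysics.QuantumLattice.WilsonLoops
import Literature.MathematicalPhysics.QuantumLattice.WilsonLoopsProofs
import Literature.MathematicalPhysics.QuantumFieldTheory.ShenZhuZhuErgodicity
import Literature.MathematicalPhysics.QuantumFieldTheory.Balaban1983to89.TraceWordsSeparateOrbitsOrthogonal
import Literature.Barriers.QuantumFields.ToronPlaneAnticorrelation
import HarnessLib

/-!
# Shen–Zhu–Zhu's applications of the Poincaré inequality: susceptibility bounds for links and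
# plaquettes (Cor. 4.7–4.8) and the large-`N` variance bound for Wilson loops (Cor. 1.5),
# for `SO(N)` and `SU(N)` (CMP 400 (2023) 805–851 = arXiv:2204.12737, §1.2, §4.1, §4.2)

Numbers are those of arXiv:2204.12737v1 (the only arXiv version; theorem counter shared by
Theorem/Lemma/Corollary/Remark, Assumption counted separately), checked against the LaTeX source.

Setting (SZZ §1.1): `G ∈ {SO(N), SU(N)}`, torus `Λ_L`, 't Hooft-scaled Wilson action
`𝒮(Q) = Nβ Σ_{p ∈ 𝒫⁺} Re Tr Q_p` ((1.2)), `μ_{Λ_L,N,β} ∝ exp(𝒮) Π dσ_N` ((1.1)); Assumption 1.1: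
`K_𝒮 = (N+2)/4 - 1 - 8N|β|(d-1) > 0` (`SO(N)`), `K_𝒮 = (N+2)/2 - 1 - 8N|β|(d-1) > 0` (`SU(N)`), i.e.
(1.3) `|β| < 1/(32(d-1)) - 1/(16N(d-1))` resp. `|β| < 1/(16(d-1))` — the tree's
`szzBakryEmeryConstSO/SU`, `szzThresholdSO/SU` (`THooftRegimeThresholds`). In the tree's torus
vocabulary (`ConstructiveQFTWave0`) `μ_{Λ_L,N,β}` is `wilsonMeasure ρ (Nβ)` (weight
`exp(-β' Σ_p (N - Re tr ρ(U_p)))`, so `β' = Nβ`), with `ρ = fundamentalRep (Fin N)` for `SU(N)` and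
`ρ = specialOrthogonalRep (Fin N)` (real matrices read in `ℂ`) for `SO(N)`; the infinite-volume
measure `μ^{YM}_{N,β}` of Theorem 1.2 is any element of `infiniteVolumeLimitPoints ρ (Nβ)` (the tight
limits of the periodic states; by Theorem 1.2 (2) there is exactly one).

Typed here, as named facts (`def … : Prop`, not proved here) with the printed constants:

* **Corollary 4.7** (`shenZhuZhu_linkSusceptibility`): under Assumption 1.1, for every `L`, every
  link `e₀ ∈ E⁺_{Λ_L}` and every unit vector `E ∈ M_N` (`⟨E,E⟩ = Re Tr(EE^*) = 1`, (2.3)),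
  `Σ_{e ∈ E⁺_{Λ_L}} Cov_{N,β,L}(⟨Q_{e₀},E⟩, ⟨Q_e,E⟩) ≤ γ/K_𝒮` and
  `|Σ_{e ≠ e₀} Cov_{N,β,L}(⟨Q_{e₀},E⟩, ⟨Q_e,E⟩)| ≤ 2γ/K_𝒮`, `γ = 1` (`SO(N)`), `γ = 2` (`SU(N)`).
* **Corollary 4.8** (`shenZhuZhu_plaquetteSusceptibility`): under Assumption 1.1, for every
  plaquette `p ∈ 𝒫⁺_{Λ_L}`, `Σ_{p̄} Cov_{N,β,L}(Re Tr Q_p, Re Tr Q_{p̄}) ≤ 8N(d-1)/K_𝒮` (`SO(N)`),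
  `16N(d-1)/K_𝒮` (`SU(N)`), and `|Σ_{p̄ ≠ p} Cov(…)| ≤ (8N(d-1)+4N)/K_𝒮` resp. `(16N(d-1)+8N)/K_𝒮`.
* **Corollary 1.5, (1.12)** (`shenZhuZhu_largeN_variance`): under Assumption 1.1, for every loop
  `ℓ = e₁⋯e_n` (closed lattice path without backtracking, `n ≥ 1` edges) and
  `W_ℓ = Tr(Q_{e₁}⋯Q_{e_n})` ((1.11)), `Var(W_ℓ/N) ≤ n(n-3)/(K_𝒮 N)` (`SO(N)`) and
  `Var(W_ℓ/N) ≤ 4n(n-3)/(K_𝒮 N)` (`SU(N)`) under `μ^{YM}_{N,β}`.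

The CONCLUSION shapes are separate parameterised definitions (`SZZLinkSusceptibilityBound`,
`SZZPlaquetteSusceptibilityBound`, `SZZLoopVarianceBound`) so that sharper Bakry–Émery constants
(the venture's `Λ₀ = 4d`) can reuse them.

**Flags (faithfulness).** (a) Cor. 4.8 prints the first sum over "`p̄ ∈ 𝒫_{Λ_L}`"; its proof
(translation invariance applied to `f = |𝒫⁺|^{-1/2} Σ_{p̄ ∈ 𝒫⁺} Re Tr Q_{p̄}`) establishes, and the
second display uses, the sum over `𝒫⁺_{Λ_L}` — one term per unoriented plaquette — which is what is
typed (`Plaquette d L`). (b) For `SU(N)` the Wilson loop `W_ℓ` is complex; SZZ prove (1.12) "for the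
real and imaginary parts" (`𝓔(f_R,f_R), 𝓔(f_I,f_I) ≤ 2n(n-3)/N`), so `Var(W_ℓ/N)` is rendered as
`Var(Re W_ℓ/N) + Var(Im W_ℓ/N)`. (c) "`E` a unit vector in `M_N`" is read with `M_N = M_N(ℂ)` (§3:
"`M_N(ℂ)` (denoted as `M_N` below)") and the Hilbert–Schmidt norm (2.3). (d) `L > 1` as in Cor. 4.4
("for each `L > 1`"). (e) The torus `Λ_L = ℤ^d ∩ L𝕋^d` with periodic functions is the discrete
torus `(ℤ/L)^d` of `ConstructiveQFTWave0` (`Site d L`, `Edge d L` = `E⁺_{Λ_L}`, `Plaquette d L` =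
`𝒫⁺_{Λ_L}`). (f) Loops: SZZ's loops are cyclic classes of closed paths with no two successive edges
`e⁻¹e`; a representative is a closed walk in the nearest-neighbour graph `zdGraph d` whose dart list,
read cyclically, never backtracks (`IsNonBacktrackingLoop`); `W_ℓ` does not depend on the
representative (cyclicity of the trace), so nothing is lost.

PROVED here (Revision 2, from the fact `shenZhuZhu_largeN_variance`, no new fact): the printed
consequences of (1.12) — **(1.13)**, `|W_ℓ/N - 𝐄W_ℓ/N| → 0` in probability as `N → ∞`, and the
**factorisation of Wilson loops**, `𝐄(W_{ℓ₁}⋯W_{ℓ_m}/N^m) - Π_i 𝐄(W_{ℓ_i}/N) → 0` — by SZZ's own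
argument (Chebyshev; Cauchy–Schwarz and induction, p. 24): quantitative per-`N` forms
`SZZLoopVarianceBound.measureReal_deviation_le` (`μ{ε ≤ |W_ℓ/N - 𝐄W_ℓ/N|} ≤ C n(n-3)/(N ε²)`) and
`SZZLoopVarianceBound.norm_integral_prod_sub_le` (`≤ Σ_i (C n_i(n_i-3)/N)^{1/2}`) for any continuous
representation by unitary matrices, and the `N → ∞` statements `shenZhuZhu_largeN_inProbability_SU/_SO`,
`shenZhuZhu_largeN_factorisation_SU/_SO` along the families `SU(N)` (`|β| < 1/(16(d-1))`) and `SO(N)`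
(`|β| < 1/(32(d-1))`, the `N → ∞` form of (1.3)); see the section «Large-`N` consequences» below.

Not here: the proofs of Cor. 4.7, 4.8 and (1.12) themselves (Poincaré inequality (4.11)/(4.13)
applied to `f = |E⁺|^{-1/2} Σ_e ⟨Q_e,E⟩`, `f = |𝒫⁺|^{-1/2} Σ_p Re Tr Q_p`, `f = W_ℓ/N`, pp. 20–24);
Cor. 4.7–4.8 for other boundary conditions.

## References

* H. Shen, R. Zhu, X. Zhu, *A stochastic analysis approach to lattice Yang–Mills at strong coupling*,
  CMP 400 (2023) 805–851 = arXiv:2204.12737v1: (1.1)–(1.3) p. 4, (1.11)–(1.13) and Corollary 1.5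
  p. 6–7, (2.3) p. 9, Corollary 4.7 and Corollary 4.8 with proofs p. 20–22, (4.14), §4.2 (proof of
  Cor. 1.5, (4.15)–(4.18)) p. 22–24 [ShenZhuZhuCMP2023].
-/

noncomputable section

open MeasureTheory ProbabilityTheory SimpleGraph
open scoped Matrix
open Literature.MathematicalPhysics.QuantumLattice
open Literature.Probability.LatticeModels (zdGraph)
open Literature.MathematicalPhysics.QuantumFieldTheory.Balaban1983to89.TraceWordsSeparateOrbitsOrthogonal
  (specialOrthogonalRep continuous_specialOrthogonalRep)
open Literature.Barriers.QuantumFields (plaquetteReTrace)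

namespace Literature.MathematicalPhysics.QuantumFieldTheory

/-! ### The observables -/

section Observables

variable {d L N : ℕ} {G : Type*} [Group G] (ρ : G →* Matrix (Fin N) (Fin N) ℂ)

/-- The component `⟨Q_e, E⟩ = Re Tr(Q_e E^*)` of the link matrix `Q_e = ρ(U_e)` along a fixed matrix
`E ∈ M_N(ℂ)` (Hilbert–Schmidt inner product (2.3)), the observable of SZZ's Corollary 4.7.
[cite: ShenZhuZhuCMP2023, Corollary 4.7] -/
def linkHSComponent (E : Matrix (Fin N) (Fin N) ℂ) (e : Edge d L) (U : GaugeConfig d L G) : ℝ :=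
  (ρ (U e) * Eᴴ).trace.re

/-- Unfolding `linkHSComponent`. [cite: ShenZhuZhuCMP2023, (2.3)] -/
@[simp] theorem linkHSComponent_apply (E : Matrix (Fin N) (Fin N) ℂ) (e : Edge d L)
    (U : GaugeConfig d L G) : linkHSComponent ρ E e U = (ρ (U e) * Eᴴ).trace.re := rfl

end Observables

/-! ### Loops without backtracking and the Wilson loop variable `W_ℓ` on `ℤ^d` -/

section Loops

variable {d N : ℕ} {G : Type*} [Group G] (ρ : G →* Matrix (Fin N) (Fin N) ℂ)

/-- SZZ's **loops** (§1.2, before (1.11)): a loop is (a cyclic class of) a closed lattice path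
`e₁e₂⋯e_n`, `n ≥ 1`, with "no two successive edges of the form `e⁻¹e`". On a closed walk `w` of the
nearest-neighbour graph of `ℤ^d` this reads: `w` is non-empty and its dart list, read cyclically
(the last dart followed by the first), contains no dart immediately followed by its reverse.
[cite: ShenZhuZhuCMP2023, (1.11)] -/
def IsNonBacktrackingLoop {x : Literature.Probability.LatticeModels.Site d} (w : (zdGraph d).Walk x x) :
    Prop :=
  0 < w.length ∧ List.IsChain (fun a b => b ≠ a.symm) (w.darts ++ w.darts.take 1)

/-- The **Wilson loop variable** `W_ℓ = Tr(Q_{e₁}Q_{e₂}⋯Q_{e_n})` ((1.11)) of the closed walk `w`,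
`Q_e = ρ(U_e)` and `Q_{e⁻¹} = Q_e⁻¹`: the (complex) trace of `ρ` of the walk holonomy
(`walkHolonomy`). For `SO(N)` it is real. [cite: ShenZhuZhuCMP2023, (1.11)] -/
def wilsonLoopTrace {x : Literature.Probability.LatticeModels.Site d} (w : (zdGraph d).Walk x x)
    (U : LGConfig d G) : ℂ :=
  (ρ (walkHolonomy U w)).trace

/-- Unfolding `wilsonLoopTrace`. [cite: ShenZhuZhuCMP2023, (1.11)] -/
@[simp] theorem wilsonLoopTrace_apply {x : Literature.Probability.LatticeModels.Site d}
    (w : (zdGraph d).Walk x x) (U : LGConfig d G) :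
    wilsonLoopTrace ρ w U = (ρ (walkHolonomy U w)).trace := rfl

end Loops

/-! ### Conclusion shapes with the constants as parameters -/

section Shapes

variable {N : ℕ} {G : Type*} [Group G] [TopologicalSpace G] [IsTopologicalGroup G] [CompactSpace G]
  [MeasurableSpace G] [BorelSpace G] (ρ : G →* Matrix (Fin N) (Fin N) ℂ)

/-- The CONCLUSION of SZZ's Corollary 4.7 with constants `γ, K` and tree coupling `β'`: on every
torus `Λ_L`, `L > 1`, for every link `e₀` and every `E ∈ M_N(ℂ)` with `Re Tr(EE^*) = 1`,
`Σ_{e ∈ E⁺_{Λ_L}} Cov_{μ_L}(⟨Q_{e₀},E⟩, ⟨Q_e,E⟩) ≤ γ/K` and `|Σ_{e ≠ e₀} Cov_{μ_L}(⟨Q_{e₀},E⟩, ⟨Q_e,E⟩)| ≤ 2γ/K`,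
`μ_L = wilsonMeasure ρ β'`. [cite: ShenZhuZhuCMP2023, Corollary 4.7] -/
def SZZLinkSusceptibilityBound (d : ℕ) (β' γ K : ℝ) : Prop :=
  ∀ (L : ℕ) [NeZero L], 1 < L → ∀ (e₀ : Edge d L) (E : Matrix (Fin N) (Fin N) ℂ), (E * Eᴴ).trace.re = 1 →
    (∑ e : Edge d L, cov[linkHSComponent ρ E e₀, linkHSComponent ρ E e;
        wilsonMeasure (d := d) (L := L) ρ β'] ≤ γ / K) ∧
    |∑ e ∈ Finset.univ.erase e₀, cov[linkHSComponent ρ E e₀, linkHSComponent ρ E e;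
        wilsonMeasure (d := d) (L := L) ρ β']| ≤ 2 * γ / K

/-- The CONCLUSION of SZZ's Corollary 4.8 with constants `A, B` and tree coupling `β'`: on every
torus `Λ_L`, `L > 1`, for every plaquette `p ∈ 𝒫⁺_{Λ_L}`,
`Σ_{p̄ ∈ 𝒫⁺_{Λ_L}} Cov_{μ_L}(Re Tr Q_p, Re Tr Q_{p̄}) ≤ A` and `|Σ_{p̄ ≠ p} Cov_{μ_L}(Re Tr Q_p, Re Tr Q_{p̄})| ≤ B`,
`μ_L = wilsonMeasure ρ β'`, `Re Tr Q_p = plaquetteReTrace ρ p`. [cite: ShenZhuZhuCMP2023, Corollary 4.8] -/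
def SZZPlaquetteSusceptibilityBound (d : ℕ) (β' A B : ℝ) : Prop :=
  ∀ (L : ℕ) [NeZero L], 1 < L → ∀ (p : Plaquette d L),
    (∑ q : Plaquette d L, cov[plaquetteReTrace ρ p, plaquetteReTrace ρ q;
        wilsonMeasure (d := d) (L := L) ρ β'] ≤ A) ∧
    |∑ q ∈ Finset.univ.erase p, cov[plaquetteReTrace ρ p, plaquetteReTrace ρ q;
        wilsonMeasure (d := d) (L := L) ρ β']| ≤ B

/-- The CONCLUSION of SZZ's Corollary 1.5, (1.12), with constant `C` in place of `1/K_𝒮` resp.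
`4/K_𝒮` and tree coupling `β'`: for every infinite-volume limit point `μ` of the periodic states
(`infiniteVolumeLimitPoints ρ β'`; SZZ's `μ^{YM}_{N,β}`) and every loop `ℓ` with `n` edges,
`Var_μ(Re W_ℓ/N) + Var_μ(Im W_ℓ/N) ≤ C · n(n-3)/N` (for `SO(N)`, `Im W_ℓ = 0`).
[cite: ShenZhuZhuCMP2023, (1.12)] -/
def SZZLoopVarianceBound (d : ℕ) (β' C : ℝ) : Prop :=
  ∀ μ ∈ infiniteVolumeLimitPoints (d := d) ρ β',
    ∀ (x : Literature.Probability.LatticeModels.Site d) (w : (zdGraph d).Walk x x), IsNonBacktrackingLoop w →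
      Var[fun U => (wilsonLoopTrace ρ w U).re / N; μ] + Var[fun U => (wilsonLoopTrace ρ w U).im / N; μ] ≤
        C * ((w.length : ℝ) * ((w.length : ℝ) - 3) / N)

end Shapes

/-! ### The named facts (Corollaries 4.7, 4.8 and 1.5 as printed, both structure groups) -/

/-- **Shen–Zhu–Zhu, Corollary 4.7** (susceptibility bound for the link field; arXiv:2204.12737v1
p. 20–21). "Under Assumption 1.1, for every `e₀ ∈ E⁺` and every unit vector `E` in `M_N` we have
`Σ_{e ∈ E⁺_{Λ_L}} Cov_{N,β,L}(⟨Q_{e₀},E⟩, ⟨Q_e,E⟩) ≤ 1/K_𝒮` (`G = SO(N)`), `≤ 2/K_𝒮` (`G = SU(N)`).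
Here `Cov_{N,β,L}` means covariance w.r.t. the measure `μ_{Λ_L,N,β}`. In particular,
`|Σ_{e ∈ E⁺_{Λ_L} \ {e₀}} Cov_{N,β,L}(⟨Q_{e₀},E⟩, ⟨Q_e,E⟩)| ≤ 2/K_𝒮` (`SO(N)`), `≤ 4/K_𝒮` (`SU(N)`)."
(Proof: Poincaré inequality (4.11) for `f = |E⁺_{Λ_L}|^{-1/2} Σ_e ⟨Q_e,E⟩`, `|∇f|² ≤ γ`, and translation
invariance of the periodic measure.) Rendered on the discrete torus `(ℤ/L)^d`, `L > 1`, `d ≥ 2`,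
`N ≥ 1`, with Assumption 1.1 in its equivalent form (1.3): first conjunct `G = SU(N)` in the
fundamental representation at tree coupling `Nβ`, `|β| < 1/(16(d-1))`, `K_𝒮 = szzBakryEmeryConstSU N d β`,
`γ = 2`; second conjunct `G = SO(N)` (real orthogonal matrices of determinant one, read in `M_N(ℂ)`),
`|β| < 1/(32(d-1)) - 1/(16N(d-1))`, `K_𝒮 = szzBakryEmeryConstSO N d β`, `γ = 1`. See the module
docstring, flags (c)–(e). [cite: ShenZhuZhuCMP2023, Corollary 4.7] -/
def shenZhuZhu_linkSusceptibility (d N : ℕ) : Prop :=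
  (2 ≤ d → 1 ≤ N → ∀ β : ℝ, |β| < szzThresholdSU d →
    SZZLinkSusceptibilityBound (fundamentalRep (Fin N)) d ((N : ℝ) * β) 2 (szzBakryEmeryConstSU N d β)) ∧
  (2 ≤ d → 1 ≤ N → ∀ β : ℝ, |β| < szzThresholdSO N d →
    SZZLinkSusceptibilityBound (specialOrthogonalRep (Fin N)) d ((N : ℝ) * β) 1 (szzBakryEmeryConstSO N d β))

/-- **Shen–Zhu–Zhu, Corollary 4.8** (susceptibility bound for the "microscopic Wilson loops"
`Re Tr Q_p`; arXiv:2204.12737v1 p. 21–22). "Under Assumption 1.1, it holds that for every plaquette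
`p` in `𝒫⁺_{Λ_L}`, `Σ_{p̄ ∈ 𝒫_{Λ_L}} Cov_{N,β,L}(ReTr Q_p, ReTr Q_{p̄}) ≤ 8N(d-1)/K_𝒮` (`G = SO(N)`),
`≤ 16N(d-1)/K_𝒮` (`G = SU(N)`). … In particular, for every plaquette `p` in `𝒫⁺_{Λ_L}`,
`|Σ_{p̄ ∈ 𝒫_{Λ_L}, p̄ ≠ p} Cov_{N,β,L}(ReTr Q_p, ReTr Q_{p̄})| ≤ (8N(d-1)+4N)/K_𝒮` (`SO(N)`),
`≤ (16N(d-1)+8N)/K_𝒮` (`SU(N)`)." (Proof: Poincaré inequality for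
`f = |𝒫⁺_{Λ_L}|^{-1/2} Σ_{p̄ ∈ 𝒫⁺} ReTr Q_{p̄}`, `|∇f|² ≤ 8N(d-1)` via (3.2)/(3.4) and
`|𝒫⁺| = (2(d-1)/4)|E⁺|`, translation invariance, and `Var(ReTr Q_p) ≤ 4N/K_𝒮`; `SU(N)` via (4.14).)
Rendered on `(ℤ/L)^d`, `L > 1`, `d ≥ 2`, `N ≥ 1`, sums over `𝒫⁺_{Λ_L} = Plaquette d L` (flag (a) of the
module docstring: the printed "`𝒫_{Λ_L}`" in the first display is established in the proof for `𝒫⁺`):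
first conjunct `SU(N)`, `|β| < 1/(16(d-1))`; second conjunct `SO(N)`, `|β| < 1/(32(d-1)) - 1/(16N(d-1))`.
[cite: ShenZhuZhuCMP2023, Corollary 4.8] -/
def shenZhuZhu_plaquetteSusceptibility (d N : ℕ) : Prop :=
  (2 ≤ d → 1 ≤ N → ∀ β : ℝ, |β| < szzThresholdSU d →
    SZZPlaquetteSusceptibilityBound (fundamentalRep (Fin N)) d ((N : ℝ) * β)
      (16 * N * ((d : ℝ) - 1) / szzBakryEmeryConstSU N d β)
      ((16 * N * ((d : ℝ) - 1) + 8 * N) / szzBakryEmeryConstSU N d β)) ∧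
  (2 ≤ d → 1 ≤ N → ∀ β : ℝ, |β| < szzThresholdSO N d →
    SZZPlaquetteSusceptibilityBound (specialOrthogonalRep (Fin N)) d ((N : ℝ) * β)
      (8 * N * ((d : ℝ) - 1) / szzBakryEmeryConstSO N d β)
      ((8 * N * ((d : ℝ) - 1) + 4 * N) / szzBakryEmeryConstSO N d β))

/-- **Shen–Zhu–Zhu, Corollary 1.5, the variance bound (1.12)** (large `N` limit of Wilson loops;
arXiv:2204.12737v1 p. 6–7, proof §4.2 p. 22–24). "Under Assumption 1.1, for every Wilson loop
(1.11) [`W_ℓ = Tr(Q_{e₁}Q_{e₂}⋯Q_{e_n})`, `ℓ = e₁e₂⋯e_n` a loop], writing `Var` and `𝐄` for the variance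
and expectation under the measure `μ^{YM}_{N,β}` in Theorem 1.2, one has
`Var(W_ℓ/N) ≤ n(n-3)/(K_𝒮 N)` (`G = SO(N)`); `Var(W_ℓ/N) ≤ 4n(n-3)/(K_𝒮 N)` (`G = SU(N)`)."
Rendered for `d ≥ 2`, `N ≥ 1`, Assumption 1.1 as (1.3), `μ^{YM}_{N,β}` = any infinite-volume limit
point of the periodic states at tree coupling `Nβ` (unique by Theorem 1.2 (2)), loops as closed
non-backtracking walks in `ℤ^d` with `n = length` (flag (f)), and, for `SU(N)`, `Var(W_ℓ/N)` of the
complex variable as `Var(Re W_ℓ/N) + Var(Im W_ℓ/N)` (flag (b)): first conjunct `SU(N)` with `4/K_𝒮`,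
second `SO(N)` with `1/K_𝒮`. The printed consequences — (1.13) `|W_ℓ/N - 𝐄W_ℓ/N| → 0` in probability
and the factorisation `lim_N 𝐄(W_{ℓ₁}⋯W_{ℓ_m}/N^m) = lim_N Π_i 𝐄(W_{ℓ_i}/N)` — follow by Chebyshev and
induction and are not part of this fact. [cite: ShenZhuZhuCMP2023, Corollary 1.5] -/
def shenZhuZhu_largeN_variance (d N : ℕ) : Prop :=
  (2 ≤ d → 1 ≤ N → ∀ β : ℝ, |β| < szzThresholdSU d →
    SZZLoopVarianceBound (fundamentalRep (Fin N)) d ((N : ℝ) * β) (4 / szzBakryEmeryConstSU N d β)) ∧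
  (2 ≤ d → 1 ≤ N → ∀ β : ℝ, |β| < szzThresholdSO N d →
    SZZLoopVarianceBound (specialOrthogonalRep (Fin N)) d ((N : ℝ) * β) (1 / szzBakryEmeryConstSO N d β))

/-! ### Bookkeeping: monotonicity of the shapes in their constants, the single-plaquette variance -/

section Bookkeeping

variable {N : ℕ} {G : Type*} [Group G] [TopologicalSpace G] [IsTopologicalGroup G] [CompactSpace G]
  [MeasurableSpace G] [BorelSpace G] (ρ : G →* Matrix (Fin N) (Fin N) ℂ) {d : ℕ} {β' : ℝ}

/-- A loop-variance bound with constant `C` implies the bound with any larger constant `C'`, for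
loops with `n ≥ 3` edges (every loop in `ℤ^d` has `n ≥ 4`). [cite: ShenZhuZhuCMP2023, (1.12)] -/
theorem SZZLoopVarianceBound.mono {C C' : ℝ} (h : SZZLoopVarianceBound ρ d β' C) (hle : C ≤ C') :
    ∀ μ ∈ infiniteVolumeLimitPoints (d := d) ρ β',
      ∀ (x : Literature.Probability.LatticeModels.Site d) (w : (zdGraph d).Walk x x),
        IsNonBacktrackingLoop w → 3 ≤ w.length →
        Var[fun U => (wilsonLoopTrace ρ w U).re / N; μ] + Var[fun U => (wilsonLoopTrace ρ w U).im / N; μ] ≤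
          C' * ((w.length : ℝ) * ((w.length : ℝ) - 3) / N) := by
  intro μ hμ x w hw hn
  refine (h μ hμ x w hw).trans (mul_le_mul_of_nonneg_right hle ?_)
  have h3 : (3 : ℝ) ≤ w.length := by exact_mod_cast hn
  have : (0 : ℝ) ≤ (w.length : ℝ) * ((w.length : ℝ) - 3) := by nlinarith
  positivity

/-- The plaquette-susceptibility shape is monotone in its two constants. [cite: ShenZhuZhuCMP2023, Corollary 4.8] -/
theorem SZZPlaquetteSusceptibilityBound.mono {A B A' B' : ℝ} (h : SZZPlaquetteSusceptibilityBound ρ d β' A B)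
    (hA : A ≤ A') (hB : B ≤ B') : SZZPlaquetteSusceptibilityBound ρ d β' A' B' := by
  intro L _ hL p
  obtain ⟨h₁, h₂⟩ := h L hL p
  exact ⟨h₁.trans hA, h₂.trans hB⟩

/-- The link-susceptibility shape is monotone in `γ` for `K > 0`. [cite: ShenZhuZhuCMP2023, Corollary 4.7] -/
theorem SZZLinkSusceptibilityBound.mono {γ γ' K : ℝ} (h : SZZLinkSusceptibilityBound ρ d β' γ K)
    (hK : 0 < K) (hγ : γ ≤ γ') : SZZLinkSusceptibilityBound ρ d β' γ' K := by
  intro L _ hL e₀ E hE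
  obtain ⟨h₁, h₂⟩ := h L hL e₀ E hE
  refine ⟨h₁.trans (div_le_div_of_nonneg_right hγ hK.le), h₂.trans ?_⟩
  exact div_le_div_of_nonneg_right (by linarith) hK.le

/-- Numerical instance of Corollary 4.8 (`SU(N)`, `d = 4`): the plaquette susceptibility constant is
`48N/K_𝒮` and the off-diagonal one `56N/K_𝒮`. [cite: ShenZhuZhuCMP2023, Corollary 4.8] -/
theorem szz_plaquetteSusceptibility_consts_four (N : ℕ) (β : ℝ) :
    16 * (N : ℝ) * (((4 : ℕ) : ℝ) - 1) / szzBakryEmeryConstSU N 4 β = 48 * N / szzBakryEmeryConstSU N 4 β ∧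
    (16 * (N : ℝ) * (((4 : ℕ) : ℝ) - 1) + 8 * N) / szzBakryEmeryConstSU N 4 β =
      56 * N / szzBakryEmeryConstSU N 4 β := by
  constructor <;> · congr 1; push_cast; ring

end Bookkeeping

/-! ### The unit plaquette as a loop: non-vacuity of `IsNonBacktrackingLoop`, and Corollary 1.5 at `n = 4` -/

section Plaquette

variable {d : ℕ}

/-- The unit plaquette at `x` in the `(i, j)` plane as a closed walk of `ℤ^d`:
`x → x+eᵢ → x+eᵢ+eⱼ → x+eⱼ → x` (SZZ §1.1: "A plaquette is a closed path of length four which traces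
out the boundary of a square"). [cite: ShenZhuZhuCMP2023, §1.1] -/
def plaquetteWalk (x : Literature.Probability.LatticeModels.Site d) (i j : Fin d) : (zdGraph d).Walk x x :=
  Walk.cons (zdGraph_adj_add_single x i) <|
    Walk.cons (zdGraph_adj_add_single (x + Pi.single i 1) j) <|
      Walk.cons (show (zdGraph d).Adj (x + Pi.single i 1 + Pi.single j 1) (x + Pi.single j 1) by
          rw [add_right_comm]; exact (zdGraph_adj_add_single _ i).symm) <|
        Walk.cons (zdGraph_adj_add_single x j).symm Walk.nil

/-- A plaquette has four edges. [cite: ShenZhuZhuCMP2023, §1.1] -/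
@[simp] theorem length_plaquetteWalk (x : Literature.Probability.LatticeModels.Site d) (i j : Fin d) :
    (plaquetteWalk x i j).length = 4 := by
  simp [plaquetteWalk]

/-- `eᵢ + eⱼ ≠ 0` in `ℤ^d`. [folklore] -/
private theorem single_one_add_single_one_ne_zero (i j : Fin d) :
    (Pi.single i (1 : ℤ) : Literature.Probability.LatticeModels.Site d) + Pi.single j 1 ≠ 0 := by
  intro h
  have := congr_fun h i
  simp only [Pi.add_apply, Pi.single_eq_same, Pi.zero_apply] at this
  by_cases hij : j = i
  · subst hij; simp at this
  · rw [Pi.single_eq_of_ne (Ne.symm hij)] at this; omega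

/-- `eᵢ ≠ eⱼ` in `ℤ^d` for `i ≠ j`. [folklore] -/
private theorem single_one_ne_single_one {i j : Fin d} (hij : i ≠ j) :
    (Pi.single i (1 : ℤ) : Literature.Probability.LatticeModels.Site d) ≠ Pi.single j 1 := by
  intro h
  have := congr_fun h i
  simp [Pi.single_eq_of_ne hij] at this

/-- **The plaquette is a loop in SZZ's sense** (no backtracking, read cyclically) for `i ≠ j` —
non-vacuity of `IsNonBacktrackingLoop`. [cite: ShenZhuZhuCMP2023, §1.1] -/
theorem isNonBacktrackingLoop_plaquetteWalk (x : Literature.Probability.LatticeModels.Site d) {i j : Fin d}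
    (hij : i ≠ j) : IsNonBacktrackingLoop (plaquetteWalk x i j) := by
  refine ⟨by simp [plaquetteWalk], ?_⟩
  have h1 : x + Pi.single i 1 + Pi.single j 1 ≠ x := by
    rw [add_assoc]; intro h
    exact single_one_add_single_one_ne_zero i j (add_left_cancel (a := x) (by rw [h, add_zero]))
  have h2 : x + Pi.single j (1 : ℤ) ≠ x + Pi.single i 1 := by
    intro h; exact single_one_ne_single_one hij (add_left_cancel h).symm
  simp only [plaquetteWalk, Walk.darts_cons, Walk.darts_nil, List.take, List.cons_append,
    List.nil_append, List.isChain_cons_cons, List.isChain_singleton, and_true, ne_eq,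
    Dart.ext_iff, Dart.symm_toProd, Prod.swap_prod_mk, Prod.mk.injEq, true_and]
  refine ⟨?_, ?_, ?_, ?_⟩
  all_goals first | exact h1 | exact h2 | exact fun h => h1 h.symm | exact fun h => h2 h.symm

variable {N : ℕ} {G : Type*} [Group G] [TopologicalSpace G] [IsTopologicalGroup G] [CompactSpace G]
  [MeasurableSpace G] [BorelSpace G] (ρ : G →* Matrix (Fin N) (Fin N) ℂ)

/-- **Corollary 1.5 at `n = 4`**: a loop-variance bound with constant `C` gives, for the plaquette
variable `W_p = Tr Q_p` read as a Wilson loop, `Var(Re W_p/N) + Var(Im W_p/N) ≤ C · 4/N` — e.g.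
`16/(K_𝒮 N)` for `SU(N)` and `4/(K_𝒮 N)` for `SO(N)` from `shenZhuZhu_largeN_variance`.
[cite: ShenZhuZhuCMP2023, (1.12)] -/
theorem SZZLoopVarianceBound.plaquette {β' C : ℝ} (h : SZZLoopVarianceBound ρ d β' C)
    {μ : Measure (LGConfig d G)} (hμ : μ ∈ infiniteVolumeLimitPoints (d := d) ρ β')
    (x : Literature.Probability.LatticeModels.Site d) {i j : Fin d} (hij : i ≠ j) :
    Var[fun U => (wilsonLoopTrace ρ (plaquetteWalk x i j) U).re / N; μ] +
        Var[fun U => (wilsonLoopTrace ρ (plaquetteWalk x i j) U).im / N; μ] ≤ C * (4 / N) := by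
  have := h μ hμ x (plaquetteWalk x i j) (isNonBacktrackingLoop_plaquetteWalk x hij)
  simp only [length_plaquetteWalk, Nat.cast_ofNat] at this
  convert this using 2
  norm_num

end Plaquette

/-! ### Large-`N` consequences of Corollary 1.5: (1.13) and the factorisation of Wilson loops (PROVED)

SZZ p. 6–7 (Corollary 1.5, continued): "In particular, we obtain the convergence
`|W_ℓ/N - 𝐄W_ℓ/N| → 0` (`N → ∞`) in probability ((1.13)), and the factorization property of Wilson
loops, i.e. for any loops `ℓ₁, …, ℓ_m`, `lim_{N→∞} 𝐄(W_{ℓ₁}⋯W_{ℓ_m}/N^m) = lim_{N→∞} Π_{i=1}^m 𝐄(W_{ℓ_i}/N)`."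
Proof (p. 24): Chebyshev for (1.13); "To prove the factorization property, by the Cauchy–Schwarz
inequality we have `N^{-n}|𝐄(W_{ℓ₁}⋯W_{ℓ_n}) - 𝐄(W_{ℓ₁}⋯W_{ℓ_{n-1}})𝐄W_{ℓ_n}|
≤ N^{-n}|𝐄(W_{ℓ₁}⋯W_{ℓ_{n-1}}(W_{ℓ_n} - 𝐄W_{ℓ_n}))| ≤ Var(W_{ℓ_n}/N)^{1/2} → 0`. Hence, the result
follows by induction."

Both are DERIVED here from the variance bound (1.12), in two layers.
(i) One structure group, one state: from any `SZZLoopVarianceBound ρ d β' C`, for a continuous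
representation `ρ` by unitary matrices (so `|W_ℓ/N| ≤ 1`, `norm_wilsonLoopTrace_div_le_one`) and any
infinite-volume limit point `μ`, the quantitative forms
`μ{ε ≤ |W_ℓ/N - 𝐄W_ℓ/N|} ≤ C·n(n-3)/(N ε²)` (`SZZLoopVarianceBound.measureReal_deviation_le`) and
`|𝐄 Π_i W_{ℓ_i}/N - Π_i 𝐄 W_{ℓ_i}/N| ≤ Σ_i (C·n_i(n_i-3)/N)^{1/2}`
(`SZZLoopVarianceBound.norm_integral_prod_sub_le`, the printed induction).
(ii) The printed `N → ∞` statements along the two families, for ANY choice `N ↦ μ_N` of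
infinite-volume limit points (by Theorem 1.2 (2) there is exactly one for each `N`): `SU(N)` under
(1.3), `|β| < 1/(16(d-1))` (`K_𝒮 = N(1/2 - 8|β|(d-1))`, so the two bounds are `O(N⁻²)` and `O(N⁻¹)`) —
`shenZhuZhu_largeN_inProbability_SU`, `shenZhuZhu_largeN_factorisation_SU`; and `SO(N)` under
`|β| < 1/(32(d-1))`, the `N → ∞` form of (1.3) (then Assumption 1.1 holds for all large `N`, with
`K_𝒮 = N(1/4 - 8|β|(d-1)) - 1/2`) — `shenZhuZhu_largeN_inProbability_SO`,
`shenZhuZhu_largeN_factorisation_SO`. Reading of the printed "`lim = lim`": the DIFFERENCE of the two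
sequences tends to `0` (so one limit exists iff the other does, with the same value), which is exactly
what the printed induction proves. `Var(W_ℓ/N)` of the complex variable is
`𝐄|W_ℓ/N - 𝐄W_ℓ/N|² = Var(Re W_ℓ/N) + Var(Im W_ℓ/N)` (flag (b); `integral_norm_sub_integral_sq`). -/

section ComplexChebyshev

open Filter Topology

variable {Ω : Type*} [MeasurableSpace Ω] {μ : Measure Ω} [IsProbabilityMeasure μ] {Z : Ω → ℂ}

/-- For a complex random variable with `|Z| ≤ 1`: `𝐄|Z - 𝐄Z|² = Var(Re Z) + Var(Im Z)`. [folklore] -/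
private theorem integral_norm_sub_integral_sq (hZm : Measurable Z) (hZb : ∀ ω, ‖Z ω‖ ≤ 1) :
    ∫ ω, ‖Z ω - ∫ ω', Z ω' ∂μ‖ ^ 2 ∂μ = Var[fun ω => (Z ω).re; μ] + Var[fun ω => (Z ω).im; μ] := by
  have hZi : Integrable Z μ := Integrable.of_bound hZm.aestronglyMeasurable 1 (ae_of_all _ hZb)
  have hre : (∫ ω', Z ω' ∂μ).re = ∫ ω', (Z ω').re ∂μ := by
    simpa only [RCLike.re_to_complex] using (integral_re hZi).symm
  have him : (∫ ω', Z ω' ∂μ).im = ∫ ω', (Z ω').im ∂μ := by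
    simpa only [RCLike.im_to_complex] using (integral_im hZi).symm
  have hrem : Measurable fun ω => (Z ω).re := Complex.measurable_re.comp hZm
  have himm : Measurable fun ω => (Z ω).im := Complex.measurable_im.comp hZm
  have hre2 : MemLp (fun ω => (Z ω).re - ∫ ω', (Z ω').re ∂μ) 2 μ :=
    (MemLp.of_bound hrem.aestronglyMeasurable 1 (ae_of_all _ fun ω => by
      rw [Real.norm_eq_abs]; exact (Complex.abs_re_le_norm _).trans (hZb ω))).sub (memLp_const _)
  have him2 : MemLp (fun ω => (Z ω).im - ∫ ω', (Z ω').im ∂μ) 2 μ :=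
    (MemLp.of_bound himm.aestronglyMeasurable 1 (ae_of_all _ fun ω => by
      rw [Real.norm_eq_abs]; exact (Complex.abs_im_le_norm _).trans (hZb ω))).sub (memLp_const _)
  rw [variance_eq_integral hrem.aemeasurable, variance_eq_integral himm.aemeasurable]
  have hpt : ∀ ω, ‖Z ω - ∫ ω', Z ω' ∂μ‖ ^ 2 =
      ((Z ω).re - ∫ ω', (Z ω').re ∂μ) ^ 2 + ((Z ω).im - ∫ ω', (Z ω').im ∂μ) ^ 2 := by
    intro ω
    rw [Complex.sq_norm, Complex.normSq_apply, Complex.sub_re, Complex.sub_im, hre, him]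
    ring
  simp_rw [hpt]
  exact integral_add hre2.integrable_sq him2.integrable_sq

/-- `|𝐄Z| ≤ 1` for `|Z| ≤ 1` on a probability space. [folklore] -/
private theorem norm_integral_le_one_of_norm_le_one (hZb : ∀ ω, ‖Z ω‖ ≤ 1) : ‖∫ ω, Z ω ∂μ‖ ≤ 1 := by
  simpa using norm_integral_le_of_norm_le_const (μ := μ) (f := Z) (ae_of_all _ hZb)

/-- Chebyshev's inequality for a bounded complex random variable (Markov applied to `|Z - 𝐄Z|²`):
`μ{ε ≤ |Z - 𝐄Z|} ≤ (Var(Re Z) + Var(Im Z))/ε²`. [folklore] -/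
private theorem measureReal_norm_sub_integral_ge_le (hZm : Measurable Z) (hZb : ∀ ω, ‖Z ω‖ ≤ 1)
    {ε : ℝ} (hε : 0 < ε) :
    μ.real {ω | ε ≤ ‖Z ω - ∫ ω', Z ω' ∂μ‖} ≤
      (Var[fun ω => (Z ω).re; μ] + Var[fun ω => (Z ω).im; μ]) / ε ^ 2 := by
  have hFm : Measurable fun ω => ‖Z ω - ∫ ω', Z ω' ∂μ‖ ^ 2 := (hZm.sub_const _).norm.pow_const 2
  have hmb : ‖∫ ω', Z ω' ∂μ‖ ≤ 1 := norm_integral_le_one_of_norm_le_one hZb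
  have hFb : ∀ ω, ‖Z ω - ∫ ω', Z ω' ∂μ‖ ^ 2 ≤ 4 := fun ω => by
    have h1 : ‖Z ω - ∫ ω', Z ω' ∂μ‖ ≤ 2 := (norm_sub_le _ _).trans (by linarith [hZb ω])
    nlinarith [norm_nonneg (Z ω - ∫ ω', Z ω' ∂μ)]
  have hFi : Integrable (fun ω => ‖Z ω - ∫ ω', Z ω' ∂μ‖ ^ 2) μ :=
    Integrable.of_bound hFm.aestronglyMeasurable 4 (ae_of_all _ fun ω => by
      rw [Real.norm_eq_abs, abs_of_nonneg (sq_nonneg _)]; exact hFb ω)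
  have hmarkov := mul_meas_ge_le_integral_of_nonneg (μ := μ)
    (ae_of_all _ fun ω => sq_nonneg ‖Z ω - ∫ ω', Z ω' ∂μ‖) hFi (ε ^ 2)
  rw [integral_norm_sub_integral_sq hZm hZb] at hmarkov
  have hsub : {ω | ε ≤ ‖Z ω - ∫ ω', Z ω' ∂μ‖} ⊆ {ω | ε ^ 2 ≤ ‖Z ω - ∫ ω', Z ω' ∂μ‖ ^ 2} :=
    fun ω (hω : ε ≤ _) => pow_le_pow_left₀ hε.le hω 2
  calc μ.real {ω | ε ≤ ‖Z ω - ∫ ω', Z ω' ∂μ‖}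
      ≤ μ.real {ω | ε ^ 2 ≤ ‖Z ω - ∫ ω', Z ω' ∂μ‖ ^ 2} := measureReal_mono hsub
    _ ≤ (Var[fun ω => (Z ω).re; μ] + Var[fun ω => (Z ω).im; μ]) / ε ^ 2 := by
      rw [le_div_iff₀ (pow_pos hε 2), mul_comm]; exact hmarkov

/-- Cauchy–Schwarz: `𝐄|Z - 𝐄Z| ≤ (Var(Re Z) + Var(Im Z))^{1/2}` for `|Z| ≤ 1`. [folklore] -/
private theorem integral_norm_sub_integral_le_sqrt (hZm : Measurable Z) (hZb : ∀ ω, ‖Z ω‖ ≤ 1) :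
    ∫ ω, ‖Z ω - ∫ ω', Z ω' ∂μ‖ ∂μ ≤
      Real.sqrt (Var[fun ω => (Z ω).re; μ] + Var[fun ω => (Z ω).im; μ]) := by
  rw [← integral_norm_sub_integral_sq hZm hZb]
  have hgm : Measurable fun ω => ‖Z ω - ∫ ω', Z ω' ∂μ‖ := (hZm.sub_const _).norm
  have hmb : ‖∫ ω', Z ω' ∂μ‖ ≤ 1 := norm_integral_le_one_of_norm_le_one hZb
  have hg2 : MemLp (fun ω => ‖Z ω - ∫ ω', Z ω' ∂μ‖) 2 μ :=
    MemLp.of_bound hgm.aestronglyMeasurable 2 (ae_of_all _ fun ω => by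
      rw [Real.norm_eq_abs, abs_norm]
      exact (norm_sub_le _ _).trans (by linarith [hZb ω]))
  have hv := variance_nonneg (fun ω => ‖Z ω - ∫ ω', Z ω' ∂μ‖) μ
  rw [variance_eq_sub hg2] at hv
  simp only [Pi.pow_apply] at hv
  have h0 : 0 ≤ ∫ ω, ‖Z ω - ∫ ω', Z ω' ∂μ‖ ∂μ := integral_nonneg fun ω => norm_nonneg _
  rw [Real.le_sqrt h0 (integral_nonneg fun ω => sq_nonneg _)]
  linarith

/-- The induction step of SZZ's factorisation argument (p. 24), abstractly: for complex random
variables `A, P` bounded by one and any number `π`,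
`|𝐄(AP) - 𝐄A·π| ≤ (Var(Re A) + Var(Im A))^{1/2} + |𝐄P - π|`
(`𝐄(AP) - 𝐄A 𝐄P = 𝐄((A - 𝐄A)P)`, Cauchy–Schwarz, `|𝐄A| ≤ 1`).
[cite: ShenZhuZhuCMP2023, §4.2 (proof of Corollary 1.5, p. 24)] -/
private theorem norm_integral_mul_sub_le {A P : Ω → ℂ} (hAm : Measurable A) (hPm : Measurable P)
    (hAb : ∀ ω, ‖A ω‖ ≤ 1) (hPb : ∀ ω, ‖P ω‖ ≤ 1) (π : ℂ) :
    ‖∫ ω, A ω * P ω ∂μ - (∫ ω, A ω ∂μ) * π‖ ≤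
      Real.sqrt (Var[fun ω => (A ω).re; μ] + Var[fun ω => (A ω).im; μ]) + ‖∫ ω, P ω ∂μ - π‖ := by
  have hAi : Integrable A μ := Integrable.of_bound hAm.aestronglyMeasurable 1 (ae_of_all _ hAb)
  have hPi : Integrable P μ := Integrable.of_bound hPm.aestronglyMeasurable 1 (ae_of_all _ hPb)
  have hAPi : Integrable (fun ω => A ω * P ω) μ :=
    Integrable.of_bound (hAm.mul hPm).aestronglyMeasurable 1 (ae_of_all _ fun ω => by
      rw [norm_mul]; exact mul_le_one₀ (hAb ω) (norm_nonneg _) (hPb ω))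
  have ha1 : ‖∫ ω, A ω ∂μ‖ ≤ 1 := norm_integral_le_one_of_norm_le_one hAb
  have hstep : ∫ ω, A ω * P ω ∂μ - (∫ ω, A ω ∂μ) * ∫ ω, P ω ∂μ =
      ∫ ω, (A ω - ∫ ω', A ω' ∂μ) * P ω ∂μ := by
    rw [← integral_const_mul, ← integral_sub hAPi (hPi.const_mul _)]
    congr 1 with ω
    ring
  have hstep2 : ‖∫ ω, (A ω - ∫ ω', A ω' ∂μ) * P ω ∂μ‖ ≤ ∫ ω, ‖A ω - ∫ ω', A ω' ∂μ‖ ∂μ := by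
    refine (norm_integral_le_integral_norm _).trans
      (integral_mono_of_nonneg (ae_of_all _ fun ω => norm_nonneg _)
        (hAi.sub (integrable_const _)).norm (ae_of_all _ fun ω => ?_))
    dsimp only
    rw [norm_mul]
    exact mul_le_of_le_one_right (norm_nonneg _) (hPb ω)
  calc ‖∫ ω, A ω * P ω ∂μ - (∫ ω, A ω ∂μ) * π‖
      = ‖(∫ ω, A ω * P ω ∂μ - (∫ ω, A ω ∂μ) * ∫ ω, P ω ∂μ) +
          (∫ ω, A ω ∂μ) * (∫ ω, P ω ∂μ - π)‖ := by congr 1; ring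
    _ ≤ ‖∫ ω, A ω * P ω ∂μ - (∫ ω, A ω ∂μ) * ∫ ω, P ω ∂μ‖ +
          ‖(∫ ω, A ω ∂μ) * (∫ ω, P ω ∂μ - π)‖ := norm_add_le _ _
    _ ≤ Real.sqrt (Var[fun ω => (A ω).re; μ] + Var[fun ω => (A ω).im; μ]) + ‖∫ ω, P ω ∂μ - π‖ := by
      refine add_le_add ?_ ?_
      · rw [hstep]
        exact hstep2.trans (integral_norm_sub_integral_le_sqrt hAm hAb)
      · rw [norm_mul]
        exact mul_le_of_le_one_left (norm_nonneg _) ha1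

end ComplexChebyshev

section LargeNGeneral

open Filter Topology

variable {d N : ℕ} {G : Type*} [Group G] [TopologicalSpace G] [IsTopologicalGroup G] [CompactSpace G]
  [MeasurableSpace G] [BorelSpace G] {ρ : G →* Matrix (Fin N) (Fin N) ℂ}

omit [CompactSpace G] [MeasurableSpace G] [BorelSpace G] in
/-- The Wilson loop variable `W_ℓ` is a continuous function of the configuration (for a continuous
representation `ρ`; product topology on `G^{E⁺}`). [cite: ShenZhuZhuCMP2023, (1.11)] -/
theorem continuous_wilsonLoopTrace (hρ : Continuous ρ) {x : Literature.Probability.LatticeModels.Site d}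
    (w : (zdGraph d).Walk x x) : Continuous (wilsonLoopTrace ρ w) :=
  (hρ.comp (continuous_walkHolonomy w)).matrix_trace

omit [CompactSpace G] in
/-- `W_ℓ` is a measurable function of the configuration (second-countable `G`, so that the Borel
σ-algebra of the countable product `G^{E⁺(ℤ^d)}` is the product σ-algebra). [cite: ShenZhuZhuCMP2023, (1.11)] -/
theorem measurable_wilsonLoopTrace [SecondCountableTopology G] (hρ : Continuous ρ)
    {x : Literature.Probability.LatticeModels.Site d} (w : (zdGraph d).Walk x x) :
    Measurable (wilsonLoopTrace ρ w) :=
  (continuous_wilsonLoopTrace hρ w).measurable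

omit [TopologicalSpace G] [IsTopologicalGroup G] [CompactSpace G] [MeasurableSpace G] [BorelSpace G] in
/-- `|W_ℓ/N| ≤ 1` when `ρ` takes unitary values (`|Tr Q| ≤ N` for `Q ∈ U(N)`; SZZ p. 24 use
`|W_ℓ| ≤ N` in the Cauchy–Schwarz step). [cite: ShenZhuZhuCMP2023, §4.2 (proof of Corollary 1.5, p. 24)] -/
theorem norm_wilsonLoopTrace_div_le_one (hρu : ∀ g, ρ g ∈ Matrix.unitaryGroup (Fin N) ℂ)
    {x : Literature.Probability.LatticeModels.Site d} (w : (zdGraph d).Walk x x) (U : LGConfig d G) :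
    ‖wilsonLoopTrace ρ w U / N‖ ≤ 1 := by
  have htr : ‖wilsonLoopTrace ρ w U‖ ≤ N := by
    rw [wilsonLoopTrace_apply, Matrix.trace]
    calc ‖∑ i, Matrix.diag (ρ (walkHolonomy U w)) i‖
        ≤ ∑ i, ‖Matrix.diag (ρ (walkHolonomy U w)) i‖ := norm_sum_le _ _
      _ ≤ ∑ _i : Fin N, (1 : ℝ) :=
          Finset.sum_le_sum fun i _ => entry_norm_bound_of_unitary (hρu _) i i
      _ = N := by simp
  rcases Nat.eq_zero_or_pos N with hN | hN
  · subst hN; simp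
  · have hN' : (0 : ℝ) < N := by exact_mod_cast hN
    rwa [norm_div, Complex.norm_natCast, div_le_one hN']

omit [CompactSpace G] [MeasurableSpace G] [BorelSpace G] in
/-- Products of normalised Wilson loops `Π_i W_{ℓ_i}/N` are continuous. [folklore] -/
private theorem continuous_prod_wilsonLoopTrace_div (hρ : Continuous ρ)
    (ls : List (Σ x : Literature.Probability.LatticeModels.Site d, (zdGraph d).Walk x x)) :
    Continuous fun U : LGConfig d G => (ls.map fun l => wilsonLoopTrace ρ l.2 U / N).prod :=
  continuous_list_prod ls fun l _ => (continuous_wilsonLoopTrace hρ l.2).div_const _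

omit [TopologicalSpace G] [IsTopologicalGroup G] [CompactSpace G] [MeasurableSpace G] [BorelSpace G] in
/-- Products of normalised Wilson loops are bounded by one (unitary `ρ`). [folklore] -/
private theorem norm_prod_wilsonLoopTrace_div_le_one (hρu : ∀ g, ρ g ∈ Matrix.unitaryGroup (Fin N) ℂ)
    (ls : List (Σ x : Literature.Probability.LatticeModels.Site d, (zdGraph d).Walk x x))
    (U : LGConfig d G) : ‖(ls.map fun l => wilsonLoopTrace ρ l.2 U / N).prod‖ ≤ 1 := by
  induction ls with
  | nil => simp
  | cons l ls ih =>
    rw [List.map_cons, List.prod_cons, norm_mul]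
    exact mul_le_one₀ (norm_wilsonLoopTrace_div_le_one hρu l.2 U) (norm_nonneg _) ih

/-- **SZZ Corollary 1.5, (1.13) in quantitative form** (Chebyshev from (1.12); SZZ p. 24): if the
loop-variance bound holds with constant `C` (`SZZLoopVarianceBound ρ d β' C`) for a continuous
representation `ρ` by unitary matrices, then for every infinite-volume limit point `μ`, every loop
`ℓ` with `n` edges and every `ε > 0`,
`μ{ |W_ℓ/N - 𝐄_μ W_ℓ/N| ≥ ε } ≤ C · n(n-3)/(N ε²)`. [cite: ShenZhuZhuCMP2023, Corollary 1.5 (1.13)] -/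
theorem SZZLoopVarianceBound.measureReal_deviation_le [SecondCountableTopology G] (hρ : Continuous ρ)
    (hρu : ∀ g, ρ g ∈ Matrix.unitaryGroup (Fin N) ℂ) {β' C : ℝ} (h : SZZLoopVarianceBound ρ d β' C)
    {μ : Measure (LGConfig d G)} (hμ : μ ∈ infiniteVolumeLimitPoints (d := d) ρ β')
    {x : Literature.Probability.LatticeModels.Site d} {w : (zdGraph d).Walk x x}
    (hw : IsNonBacktrackingLoop w) {ε : ℝ} (hε : 0 < ε) :
    μ.real {U | ε ≤ ‖wilsonLoopTrace ρ w U / N - ∫ V, wilsonLoopTrace ρ w V / N ∂μ‖} ≤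
      C * ((w.length : ℝ) * ((w.length : ℝ) - 3) / N) / ε ^ 2 := by
  haveI : IsProbabilityMeasure μ := by obtain ⟨L, -, hL⟩ := hμ; exact hL.1
  have hZm : Measurable fun U => wilsonLoopTrace ρ w U / N :=
    (measurable_wilsonLoopTrace hρ w).div_const _
  have hZb : ∀ U, ‖wilsonLoopTrace ρ w U / N‖ ≤ 1 := norm_wilsonLoopTrace_div_le_one hρu w
  have hV := h μ hμ x w hw
  have key := measureReal_norm_sub_integral_ge_le (μ := μ) hZm hZb hε
  simp only [Complex.div_natCast_re, Complex.div_natCast_im] at key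
  exact key.trans (div_le_div_of_nonneg_right hV (sq_nonneg ε))

/-- **SZZ Corollary 1.5, factorisation of Wilson loops in quantitative form** (the printed
induction, p. 24): if `SZZLoopVarianceBound ρ d β' C` holds for a continuous representation `ρ` by
unitary matrices, then for every infinite-volume limit point `μ` and loops `ℓ₁, …, ℓ_m` (`n_i` edges),
`|𝐄_μ Π_i (W_{ℓ_i}/N) - Π_i 𝐄_μ(W_{ℓ_i}/N)| ≤ Σ_i (C · n_i(n_i-3)/N)^{1/2}`.
[cite: ShenZhuZhuCMP2023, Corollary 1.5 (factorization)] -/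
theorem SZZLoopVarianceBound.norm_integral_prod_sub_le [SecondCountableTopology G] (hρ : Continuous ρ)
    (hρu : ∀ g, ρ g ∈ Matrix.unitaryGroup (Fin N) ℂ) {β' C : ℝ} (h : SZZLoopVarianceBound ρ d β' C)
    {μ : Measure (LGConfig d G)} (hμ : μ ∈ infiniteVolumeLimitPoints (d := d) ρ β')
    (ls : List (Σ x : Literature.Probability.LatticeModels.Site d, (zdGraph d).Walk x x))
    (hls : ∀ l ∈ ls, IsNonBacktrackingLoop l.2) :
    ‖∫ U, (ls.map fun l => wilsonLoopTrace ρ l.2 U / N).prod ∂μ -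
        (ls.map fun l => ∫ U, wilsonLoopTrace ρ l.2 U / N ∂μ).prod‖ ≤
      (ls.map fun l => Real.sqrt (C * ((l.2.length : ℝ) * ((l.2.length : ℝ) - 3) / N))).sum := by
  haveI : IsProbabilityMeasure μ := by obtain ⟨L, -, hL⟩ := hμ; exact hL.1
  induction ls with
  | nil => simp
  | cons l ls ih =>
    have hls' : ∀ l' ∈ ls, IsNonBacktrackingLoop l'.2 :=
      fun l' hl' => hls l' (List.mem_cons_of_mem _ hl')
    simp only [List.map_cons, List.prod_cons, List.sum_cons]
    have hAm : Measurable fun U => wilsonLoopTrace ρ l.2 U / N :=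
      (measurable_wilsonLoopTrace hρ l.2).div_const _
    have hAb : ∀ U, ‖wilsonLoopTrace ρ l.2 U / N‖ ≤ 1 := norm_wilsonLoopTrace_div_le_one hρu l.2
    have hPm : Measurable fun U : LGConfig d G =>
        (ls.map fun l => wilsonLoopTrace ρ l.2 U / N).prod :=
      (continuous_prod_wilsonLoopTrace_div hρ ls).measurable
    have hPb := norm_prod_wilsonLoopTrace_div_le_one hρu ls
    have hV := h μ hμ l.1 l.2 (hls l List.mem_cons_self)
    have key := norm_integral_mul_sub_le (μ := μ) hAm hPm hAb hPb
      ((ls.map fun l => ∫ U, wilsonLoopTrace ρ l.2 U / N ∂μ).prod)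
    simp only [Complex.div_natCast_re, Complex.div_natCast_im] at key
    exact key.trans (add_le_add (Real.sqrt_le_sqrt hV) (ih hls'))

end LargeNGeneral

section LargeNFamilies

open Filter Topology

variable {d : ℕ}

/-- `SU(N)` is second countable (a subspace of `M_N(ℂ)`). [folklore] -/
private theorem secondCountable_specialUnitaryGroup (N : ℕ) :
    SecondCountableTopology (Matrix.specialUnitaryGroup (Fin N) ℂ) := by
  haveI : SecondCountableTopology (Matrix (Fin N) (Fin N) ℂ) :=
    inferInstanceAs (SecondCountableTopology (Fin N → Fin N → ℂ))
  exact Topology.IsEmbedding.subtypeVal.secondCountableTopology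

/-- `SO(N)` is second countable (a subspace of `M_N(ℝ)`). [folklore] -/
private theorem secondCountable_specialOrthogonalGroup (N : ℕ) :
    SecondCountableTopology (Matrix.specialOrthogonalGroup (Fin N) ℝ) := by
  haveI : SecondCountableTopology (Matrix (Fin N) (Fin N) ℝ) :=
    inferInstanceAs (SecondCountableTopology (Fin N → Fin N → ℝ))
  exact Topology.IsEmbedding.subtypeVal.secondCountableTopology

/-- The fundamental representation of `SU(N)` is unitary-valued. [folklore] -/
private theorem fundamentalRep_mem_unitaryGroup {N : ℕ} (g : Matrix.specialUnitaryGroup (Fin N) ℂ) :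
    fundamentalRep (Fin N) g ∈ Matrix.unitaryGroup (Fin N) ℂ :=
  (Matrix.mem_specialUnitaryGroup_iff.1 g.2).1

/-- `SU(N)`: `K_𝒮 = N(1/2 - 8|β|(d-1))` grows linearly in `N`, so `(4/K_𝒮) · a/N → 0` for every
`a` (`|β| < 1/(16(d-1))`, `d ≥ 2`). [cite: ShenZhuZhuCMP2023, (1.12)] -/
private theorem tendsto_szzSU_const_mul_div {β : ℝ} (hβ : |β| < szzThresholdSU d) (hd : 2 ≤ d)
    (a : ℝ) : Tendsto (fun N : ℕ => 4 / szzBakryEmeryConstSU N d β * (a / N)) atTop (𝓝 0) := by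
  have hd' : (0 : ℝ) < (d : ℝ) - 1 := by
    have : (2 : ℝ) ≤ d := by exact_mod_cast hd
    linarith
  have hc : 0 < 1 / 2 - 8 * |β| * ((d : ℝ) - 1) := by
    rw [szzThresholdSU, lt_div_iff₀ (by positivity)] at hβ
    nlinarith [abs_nonneg β]
  have hK : ∀ N : ℕ, szzBakryEmeryConstSU N d β = N * (1 / 2 - 8 * |β| * ((d : ℝ) - 1)) :=
    fun N => by rw [szzBakryEmeryConstSU_eq]; ring
  have h1 : Tendsto (fun N : ℕ => 4 * a / (1 / 2 - 8 * |β| * ((d : ℝ) - 1)) / (N : ℝ) / (N : ℝ))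
      atTop (𝓝 0) :=
    (tendsto_const_div_atTop_nhds_zero_nat _).div_atTop tendsto_natCast_atTop_atTop
  refine h1.congr' ?_
  filter_upwards [eventually_gt_atTop 0] with N hN
  have hN' : (0 : ℝ) < N := by exact_mod_cast hN
  rw [hK]
  field_simp

/-- `SO(N)`: for `|β| < 1/(32(d-1))`, `K_𝒮 = N(1/4 - 8|β|(d-1)) - 1/2`, so `K_𝒮 · N → ∞` and
`(1/K_𝒮) · a/N → 0`. [cite: ShenZhuZhuCMP2023, (1.12)] -/
private theorem tendsto_szzSO_const_mul_div {β : ℝ} (hβ : |β| < 1 / (32 * ((d : ℝ) - 1)))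
    (hd : 2 ≤ d) (a : ℝ) :
    Tendsto (fun N : ℕ => 1 / szzBakryEmeryConstSO N d β * (a / N)) atTop (𝓝 0) := by
  have hd' : (0 : ℝ) < (d : ℝ) - 1 := by
    have : (2 : ℝ) ≤ d := by exact_mod_cast hd
    linarith
  have hc : 0 < 1 / 4 - 8 * |β| * ((d : ℝ) - 1) := by
    rw [lt_div_iff₀ (by positivity)] at hβ
    nlinarith [abs_nonneg β]
  have hK : ∀ N : ℕ, szzBakryEmeryConstSO N d β = N * (1 / 4 - 8 * |β| * ((d : ℝ) - 1)) - 1 / 2 :=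
    fun N => by unfold szzBakryEmeryConstSO; ring
  have hlin : Tendsto (fun N : ℕ => (N : ℝ) * (1 / 4 - 8 * |β| * ((d : ℝ) - 1)) - 1 / 2)
      atTop atTop := by
    have h := (tendsto_natCast_atTop_atTop (R := ℝ)).atTop_mul_const hc
    simpa [sub_eq_add_neg] using tendsto_atTop_add_const_right atTop (-(1 / 2 : ℝ)) h
  have hKN : Tendsto (fun N : ℕ => szzBakryEmeryConstSO N d β * N) atTop atTop := by
    simp_rw [hK]
    exact hlin.atTop_mul_atTop₀ tendsto_natCast_atTop_atTop
  have h1 : Tendsto (fun N : ℕ => a / (szzBakryEmeryConstSO N d β * N)) atTop (𝓝 0) :=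
    tendsto_const_nhds.div_atTop hKN
  refine h1.congr' ?_
  filter_upwards [hKN.eventually_gt_atTop 0, eventually_gt_atTop 0] with N hKNpos hN
  have hN' : (0 : ℝ) < N := by exact_mod_cast hN
  have hKne : szzBakryEmeryConstSO N d β ≠ 0 := by
    intro h0
    rw [h0, zero_mul] at hKNpos
    exact lt_irrefl _ hKNpos
  field_simp

/-- For `|β| < 1/(32(d-1))`, Shen–Zhu–Zhu's Assumption 1.1 for `SO(N)` ((1.3):
`|β| < 1/(32(d-1)) - 1/(16N(d-1))`) holds for all large `N`. [cite: ShenZhuZhuCMP2023, (1.3)] -/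
private theorem eventually_lt_szzThresholdSO {β : ℝ} (hβ : |β| < 1 / (32 * ((d : ℝ) - 1)))
    (hd : 2 ≤ d) : ∀ᶠ N : ℕ in atTop, |β| < szzThresholdSO N d := by
  have hd' : (0 : ℝ) < (d : ℝ) - 1 := by
    have : (2 : ℝ) ≤ d := by exact_mod_cast hd
    linarith
  have h0 : Tendsto (fun N : ℕ => 1 / (16 * ((d : ℝ) - 1)) / (N : ℝ)) atTop (𝓝 0) :=
    tendsto_const_div_atTop_nhds_zero_nat _
  have hδ : 0 < 1 / (32 * ((d : ℝ) - 1)) - |β| := sub_pos.2 hβ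
  filter_upwards [h0.eventually (gt_mem_nhds hδ), eventually_gt_atTop 0] with N hN hNpos
  have hN' : (0 : ℝ) < N := by exact_mod_cast hNpos
  have hrew : szzThresholdSO N d = 1 / (32 * ((d : ℝ) - 1)) - 1 / (16 * ((d : ℝ) - 1)) / (N : ℝ) := by
    unfold szzThresholdSO
    rw [div_div]
    ring
  rw [hrew]
  linarith

/-- **SZZ Corollary 1.5, (1.13)** for `G = SU(N)`, PROVED from (1.12) (`shenZhuZhu_largeN_variance`,
supplied as the hypothesis `h`, one instance per `N`): under (1.3) `|β| < 1/(16(d-1))` (`d ≥ 2`), for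
ANY choice of infinite-volume limit points `μ_N ∈ infiniteVolumeLimitPoints (fundamentalRep (Fin N)) (Nβ)`
(eventually in `N`; by Theorem 1.2 (2) there is exactly one `μ^{YM}_{N,β}`), every loop `ℓ` and every
`ε > 0`: `μ_N{ |W_ℓ/N - 𝐄W_ℓ/N| ≥ ε } → 0` as `N → ∞` (indeed `≤ 4n(n-3)/((1/2 - 8|β|(d-1)) N² ε²)`).
[cite: ShenZhuZhuCMP2023, Corollary 1.5 (1.13)] -/
theorem shenZhuZhu_largeN_inProbability_SU (h : ∀ N, shenZhuZhu_largeN_variance d N) (hd : 2 ≤ d)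
    {β : ℝ} (hβ : |β| < szzThresholdSU d)
    (μ : (N : ℕ) → Measure (LGConfig d (Matrix.specialUnitaryGroup (Fin N) ℂ)))
    (hμ : ∀ᶠ N in atTop,
      μ N ∈ infiniteVolumeLimitPoints (d := d) (fundamentalRep (Fin N)) ((N : ℝ) * β))
    {x : Literature.Probability.LatticeModels.Site d} {w : (zdGraph d).Walk x x}
    (hw : IsNonBacktrackingLoop w) {ε : ℝ} (hε : 0 < ε) :
    Tendsto (fun N : ℕ => (μ N).real {U | ε ≤ ‖wilsonLoopTrace (fundamentalRep (Fin N)) w U / N -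
        ∫ V, wilsonLoopTrace (fundamentalRep (Fin N)) w V / N ∂(μ N)‖}) atTop (𝓝 0) := by
  have hg : Tendsto (fun N : ℕ => 4 / szzBakryEmeryConstSU N d β *
      ((w.length : ℝ) * ((w.length : ℝ) - 3) / N) / ε ^ 2) atTop (𝓝 0) := by
    simpa using (tendsto_szzSU_const_mul_div hβ hd ((w.length : ℝ) * ((w.length : ℝ) - 3))).div_const
      (ε ^ 2)
  refine squeeze_zero' (Eventually.of_forall fun N => measureReal_nonneg) ?_ hg
  filter_upwards [hμ, eventually_ge_atTop 1] with N hμN hN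
  haveI := secondCountable_specialUnitaryGroup N
  exact ((h N).1 hd hN β hβ).measureReal_deviation_le (continuous_fundamentalRep (Fin N))
    fundamentalRep_mem_unitaryGroup hμN hw hε

/-- **SZZ Corollary 1.5, factorisation of Wilson loops** for `G = SU(N)`, PROVED from (1.12): under
(1.3) `|β| < 1/(16(d-1))`, for any choice of infinite-volume limit points `μ_N` (eventually in `N`) and
loops `ℓ₁, …, ℓ_m`: `𝐄_{μ_N}(W_{ℓ₁}⋯W_{ℓ_m}/N^m) - Π_i 𝐄_{μ_N}(W_{ℓ_i}/N) → 0` as `N → ∞` — the printed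
"`lim_N 𝐄(W_{ℓ₁}⋯W_{ℓ_m}/N^m) = lim_N Π_i 𝐄(W_{ℓ_i}/N)`". [cite: ShenZhuZhuCMP2023, Corollary 1.5 (factorization)] -/
theorem shenZhuZhu_largeN_factorisation_SU (h : ∀ N, shenZhuZhu_largeN_variance d N) (hd : 2 ≤ d)
    {β : ℝ} (hβ : |β| < szzThresholdSU d)
    (μ : (N : ℕ) → Measure (LGConfig d (Matrix.specialUnitaryGroup (Fin N) ℂ)))
    (hμ : ∀ᶠ N in atTop,
      μ N ∈ infiniteVolumeLimitPoints (d := d) (fundamentalRep (Fin N)) ((N : ℝ) * β))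
    (ls : List (Σ x : Literature.Probability.LatticeModels.Site d, (zdGraph d).Walk x x))
    (hls : ∀ l ∈ ls, IsNonBacktrackingLoop l.2) :
    Tendsto (fun N : ℕ =>
        ∫ U, (ls.map fun l => wilsonLoopTrace (fundamentalRep (Fin N)) l.2 U / N).prod ∂(μ N) -
          (ls.map fun l => ∫ U, wilsonLoopTrace (fundamentalRep (Fin N)) l.2 U / N ∂(μ N)).prod)
      atTop (𝓝 0) := by
  rw [tendsto_zero_iff_norm_tendsto_zero]
  have hg : Tendsto (fun N : ℕ => (ls.map fun l => Real.sqrt (4 / szzBakryEmeryConstSU N d β *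
      ((l.2.length : ℝ) * ((l.2.length : ℝ) - 3) / N))).sum) atTop (𝓝 0) := by
    have key := tendsto_list_sum (a := fun _ => (0 : ℝ)) ls (fun l _ =>
      show Tendsto (fun N : ℕ => Real.sqrt (4 / szzBakryEmeryConstSU N d β *
        ((l.2.length : ℝ) * ((l.2.length : ℝ) - 3) / N))) atTop (𝓝 0) by
        simpa only [Function.comp_def, Real.sqrt_zero] using (Real.continuous_sqrt.tendsto 0).comp
          (tendsto_szzSU_const_mul_div hβ hd ((l.2.length : ℝ) * ((l.2.length : ℝ) - 3))))
    simpa using key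
  refine squeeze_zero' (Eventually.of_forall fun N => norm_nonneg _) ?_ hg
  filter_upwards [hμ, eventually_ge_atTop 1] with N hμN hN
  haveI := secondCountable_specialUnitaryGroup N
  exact ((h N).1 hd hN β hβ).norm_integral_prod_sub_le (continuous_fundamentalRep (Fin N))
    fundamentalRep_mem_unitaryGroup hμN ls hls

/-- **SZZ Corollary 1.5, (1.13)** for `G = SO(N)`, PROVED from (1.12): for `|β| < 1/(32(d-1))` — the
`N → ∞` form of (1.3), under which Assumption 1.1 holds for all large `N` — and any choice of
infinite-volume limit points `μ_N ∈ infiniteVolumeLimitPoints (specialOrthogonalRep (Fin N)) (Nβ)`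
(eventually in `N`), every loop `ℓ` and `ε > 0`: `μ_N{ |W_ℓ/N - 𝐄W_ℓ/N| ≥ ε } → 0` as `N → ∞`.
[cite: ShenZhuZhuCMP2023, Corollary 1.5 (1.13)] -/
theorem shenZhuZhu_largeN_inProbability_SO (h : ∀ N, shenZhuZhu_largeN_variance d N) (hd : 2 ≤ d)
    {β : ℝ} (hβ : |β| < 1 / (32 * ((d : ℝ) - 1)))
    (μ : (N : ℕ) → Measure (LGConfig d (Matrix.specialOrthogonalGroup (Fin N) ℝ)))
    (hμ : ∀ᶠ N in atTop,
      μ N ∈ infiniteVolumeLimitPoints (d := d) (specialOrthogonalRep (Fin N)) ((N : ℝ) * β))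
    {x : Literature.Probability.LatticeModels.Site d} {w : (zdGraph d).Walk x x}
    (hw : IsNonBacktrackingLoop w) {ε : ℝ} (hε : 0 < ε) :
    Tendsto (fun N : ℕ => (μ N).real {U | ε ≤ ‖wilsonLoopTrace (specialOrthogonalRep (Fin N)) w U / N -
        ∫ V, wilsonLoopTrace (specialOrthogonalRep (Fin N)) w V / N ∂(μ N)‖}) atTop (𝓝 0) := by
  have hg : Tendsto (fun N : ℕ => 1 / szzBakryEmeryConstSO N d β *
      ((w.length : ℝ) * ((w.length : ℝ) - 3) / N) / ε ^ 2) atTop (𝓝 0) := by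
    simpa using (tendsto_szzSO_const_mul_div hβ hd ((w.length : ℝ) * ((w.length : ℝ) - 3))).div_const
      (ε ^ 2)
  refine squeeze_zero' (Eventually.of_forall fun N => measureReal_nonneg) ?_ hg
  filter_upwards [hμ, eventually_ge_atTop 1, eventually_lt_szzThresholdSO hβ hd] with N hμN hN hβN
  haveI := secondCountable_specialOrthogonalGroup N
  exact ((h N).2 hd hN β hβN).measureReal_deviation_le (continuous_specialOrthogonalRep (Fin N))
    specialOrthogonalRep_mem_unitaryGroup hμN hw hε

/-- **SZZ Corollary 1.5, factorisation of Wilson loops** for `G = SO(N)`, PROVED from (1.12): for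
`|β| < 1/(32(d-1))`, any choice of infinite-volume limit points `μ_N` (eventually in `N`) and loops
`ℓ₁, …, ℓ_m`: `𝐄_{μ_N}(W_{ℓ₁}⋯W_{ℓ_m}/N^m) - Π_i 𝐄_{μ_N}(W_{ℓ_i}/N) → 0` as `N → ∞`.
[cite: ShenZhuZhuCMP2023, Corollary 1.5 (factorization)] -/
theorem shenZhuZhu_largeN_factorisation_SO (h : ∀ N, shenZhuZhu_largeN_variance d N) (hd : 2 ≤ d)
    {β : ℝ} (hβ : |β| < 1 / (32 * ((d : ℝ) - 1)))
    (μ : (N : ℕ) → Measure (LGConfig d (Matrix.specialOrthogonalGroup (Fin N) ℝ)))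
    (hμ : ∀ᶠ N in atTop,
      μ N ∈ infiniteVolumeLimitPoints (d := d) (specialOrthogonalRep (Fin N)) ((N : ℝ) * β))
    (ls : List (Σ x : Literature.Probability.LatticeModels.Site d, (zdGraph d).Walk x x))
    (hls : ∀ l ∈ ls, IsNonBacktrackingLoop l.2) :
    Tendsto (fun N : ℕ =>
        ∫ U, (ls.map fun l => wilsonLoopTrace (specialOrthogonalRep (Fin N)) l.2 U / N).prod ∂(μ N) -
          (ls.map fun l => ∫ U, wilsonLoopTrace (specialOrthogonalRep (Fin N)) l.2 U / N ∂(μ N)).prod)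
      atTop (𝓝 0) := by
  rw [tendsto_zero_iff_norm_tendsto_zero]
  have hg : Tendsto (fun N : ℕ => (ls.map fun l => Real.sqrt (1 / szzBakryEmeryConstSO N d β *
      ((l.2.length : ℝ) * ((l.2.length : ℝ) - 3) / N))).sum) atTop (𝓝 0) := by
    have key := tendsto_list_sum (a := fun _ => (0 : ℝ)) ls (fun l _ =>
      show Tendsto (fun N : ℕ => Real.sqrt (1 / szzBakryEmeryConstSO N d β *
        ((l.2.length : ℝ) * ((l.2.length : ℝ) - 3) / N))) atTop (𝓝 0) by
        simpa only [Function.comp_def, Real.sqrt_zero] using (Real.continuous_sqrt.tendsto 0).comp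
          (tendsto_szzSO_const_mul_div hβ hd ((l.2.length : ℝ) * ((l.2.length : ℝ) - 3))))
    simpa using key
  refine squeeze_zero' (Eventually.of_forall fun N => norm_nonneg _) ?_ hg
  filter_upwards [hμ, eventually_ge_atTop 1, eventually_lt_szzThresholdSO hβ hd] with N hμN hN hβN
  haveI := secondCountable_specialOrthogonalGroup N
  exact ((h N).2 hd hN β hβN).norm_integral_prod_sub_le (continuous_specialOrthogonalRep (Fin N))
    specialOrthogonalRep_mem_unitaryGroup hμN ls hls

end LargeNFamilies

end Literature.MathematicalPhysics.QuantumFieldTheory
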